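import Mathlib
import Summits.NavierStokesRegularity.NavierStokesRegularity.Theses.SwirlStarvation
import HarnessLib

/-!
# Route SwirlStarvation — the three pure-logic supports `CreepDichotomy`, `StarvationFailureBlowup`,
  `NoMarginalCreepFloor` PROVED (stmt-NavierStokesRegularity-13884 / 13885 / 13886)

Elementary logic and one-line real algebra over the route's cruxes (`NoMarginalCreep`,
`MarginalCreepBlowup`, `StarvationFloor`), as announced in the route file (planner's Sketch.lean):
* `swirlStarvation_creepDichotomy_proof`: `NoMarginalCreep ↔ ¬MarginalCreepBlowup` (push the
  negation through the quantifiers);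
* `swirlStarvation_starvationFailureBlowup_proof`: `¬StarvationFloor → MarginalCreepBlowup` (with
  `y = ‖u‖√((T−t)/ν) ≥ 0` and `L = log(T/(T−t)) ≥ 0`: `y³ < L ⇒ y² ≤ 1 + L`, i.e. the spine with
  `C = 1`);
* `swirlStarvation_noMarginalCreepFloor_proof`: `NoMarginalCreep → StarvationFloor`
  (`y² > 1 + L ⇒ y > 1 ⇒ y³ ≥ y² > L`, floor constant `c = 1`).

HONEST FRAMING: pure logic; the cruxes themselves remain OPEN; nothing here bears on the regularity
question. Lands `--workitem stmt-NavierStokesRegularity-13884` (typer seat g19 of cell pub-ns-dss,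
idle-row item; the other two closed `--by`).
-/

namespace Summit.NavierStokesRegularity.NavierStokesRegularity.Theorems

set_option linter.dupNamespace false

open Set

/-- **`CreepDichotomy` (stmt-NavierStokesRegularity-13884)**: `NoMarginalCreep ↔ ¬MarginalCreepBlowup`.
[this file] -/
theorem swirlStarvation_creepDichotomy_proof : Theses.SwirlStarvation.CreepDichotomy := by
  constructor
  · rintro h ⟨ν, hν, T, hT, u, p, hmax, hLH, hdec, hax, C, t₁, ht₁, hall⟩
    obtain ⟨t, ht, x, hlt⟩ := h ν T hν hT u p hmax hLH hdec hax C t₁ ht₁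
    exact absurd hlt (not_lt.2 (hall t ht x))
  · intro h ν T hν hT u p hmax hLH hdec hax C t₁ ht₁
    by_contra hc
    apply h
    refine ⟨ν, hν, T, hT, u, p, hmax, hLH, hdec, hax, C, t₁, ht₁, fun t ht x => ?_⟩
    exact not_lt.1 fun hlt => hc ⟨t, ht, x, hlt⟩

/-- The elementary spine inequality: for `y ≥ 0`, `L ≥ 0` and `y³ < L`, `y² ≤ 1 + L`. [folklore] -/
theorem sq_le_one_add_of_cube_lt {y L : ℝ} (hy : 0 ≤ y) (hL : 0 ≤ L) (h : y ^ 3 < L) :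
    y ^ 2 ≤ 1 + L := by
  rcases le_or_gt y 1 with hy1 | hy1
  · nlinarith [mul_le_mul hy1 hy1 hy zero_le_one]
  · nlinarith [mul_le_mul_of_nonneg_left hy1.le (sq_nonneg y)]

/-- `y² = ‖u‖²(T−t)/ν` and the signs, for `y = ‖u‖√((T−t)/ν)`. [folklore] -/
theorem spine_sq_eq {ν T t : ℝ} (a : ℝ) (hν : 0 < ν) (ht : t < T) :
    (a * Real.sqrt ((T - t) / ν)) ^ 2 = a ^ 2 * (T - t) / ν := by
  rw [mul_pow, Real.sq_sqrt (div_nonneg (sub_pos.2 ht).le hν.le)]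
  ring

/-- **`StarvationFailureBlowup` (stmt-NavierStokesRegularity-13885)**: the failure of the floor crux
exhibits a marginal-creep blow-up with `C = 1`. [this file] -/
theorem swirlStarvation_starvationFailureBlowup_proof :
    Theses.SwirlStarvation.StarvationFailureBlowup := by
  intro hfail
  unfold Theses.SwirlStarvation.StarvationFloor at hfail
  push Not at hfail
  obtain ⟨ν, T, hν, hT, u, p, hmax, hLH, hdec, hax, hall⟩ := hfail
  obtain ⟨t₁, ht₁, hlt⟩ := hall 1 one_pos
  refine ⟨ν, hν, T, hT, u, p, hmax, hLH, hdec, hax, 1, t₁, ht₁, fun t ht x => ?_⟩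
  have htT : t < T := ht.2
  have ht0 : 0 ≤ t := ht₁.1.trans ht.1
  have hL : 0 ≤ Real.log (T / (T - t)) :=
    Real.log_nonneg ((one_le_div (sub_pos.2 htT)).2 (by linarith))
  have hy : 0 ≤ ‖u t x‖ * Real.sqrt ((T - t) / ν) := by positivity
  have h3 := hlt t ht x
  rw [one_mul] at h3
  have h2 := sq_le_one_add_of_cube_lt hy hL h3
  rw [spine_sq_eq _ hν htT, div_le_iff₀ hν] at h2
  linarith

/-- **`NoMarginalCreepFloor` (stmt-NavierStokesRegularity-13886)**: `NoMarginalCreep → StarvationFloor`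
with floor constant `c = 1`. [this file] -/
theorem swirlStarvation_noMarginalCreepFloor_proof :
    Theses.SwirlStarvation.NoMarginalCreepFloor := by
  intro h ν T hν hT u p hmax hLH hdec hax
  refine ⟨1, one_pos, fun t₁ ht₁ => ?_⟩
  obtain ⟨t, ht, x, hlt⟩ := h ν T hν hT u p hmax hLH hdec hax 1 t₁ ht₁
  refine ⟨t, ht, x, ?_⟩
  have htT : t < T := ht.2
  have ht0 : 0 ≤ t := ht₁.1.trans ht.1
  have hL : 0 ≤ Real.log (T / (T - t)) :=
    Real.log_nonneg ((one_le_div (sub_pos.2 htT)).2 (by linarith))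
  set y : ℝ := ‖u t x‖ * Real.sqrt ((T - t) / ν) with hydef
  have hy : 0 ≤ y := by positivity
  have hy2 : 1 + Real.log (T / (T - t)) < y ^ 2 := by
    rw [hydef, spine_sq_eq _ hν htT, lt_div_iff₀ hν]
    linarith
  have hy1 : 1 < y := by nlinarith
  rw [one_mul]
  nlinarith [mul_le_mul_of_nonneg_left hy1.le (sq_nonneg y)]

end Summit.NavierStokesRegularity.NavierStokesRegularity.Theorems
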